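import Literature.Topology.FourManifolds.KirbyMovesSlideEndThickeningDeriv
import Literature.Topology.FourManifolds.KirbyMovesSlideEndStepAData
import HarnessLib

/-!
# Normalising the band end: the flat model of the thickening

Topic `Literature/Topology/FourManifolds`; fact seat `provefact-IsStrictHandleSlide.isSurgery`
(R. C. Kirby, *The Topology of 4-Manifolds*, LNM 1374 (1989), Ch. I §4; remaining content: the
named fact (S) `Literature.Topology.FourManifolds.FramedLink.IsStrictHandleSlide.slideModel`).
The flattening of the band end (step B of its normalisation) replaces, near the attaching arc,
the thickening `thickening (x, z) = ν (circlePt (baseLift x), W x + z • e_y)` of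
`KirbyMovesSlideEndDefs.lean` by its **flat model**
`thickeningFlat (x, z) = ν (circlePt (thetaB x₁), (1 + (1 - x₀) κ(x₁)) • e₀ + z • e_y)`, whose
band `z = 0` lies in the radial half-planes through `e₀` and is a product in the coordinates
(base `= thetaB x₁`, radius affine in `x₀`); here `κ(y) = edgeRate y = -2 (D W (1, y) (1, 0))₀`
is the rate at which the band leaves the push-off (after step A, `D W (1, y) (1, 0) = -κ(y) • e₀`
with `κ > 0`). The two thickenings agree to first order along the edge in the normal directions,
and every convex combination of their derivatives there is injective — the hypothesis of the
straight-line isotopy extension (`StraightLineIsotopyExtension.lean`, as in the uniqueness of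
tubular neighbourhoods `LinkTubularUniqueness.lean`). Definitions `edgeRate`, `thickeningFlat`
(with unfolding lemmas) and theorems; no named facts.

## References

* R. C. Kirby, *The Topology of 4-Manifolds*, LNM 1374, Springer (1989), Ch. I §4. [Kirby1989]
* A. Kosinski, *Differential Manifolds* (1993), Ch. III, Thm. (3.5). [Kosinski1993]
-/

open scoped Manifold ContDiff Topology
open Function Set Metric

noncomputable section

namespace Literature.Topology.FourManifolds

namespace BandCore

variable [Knot.TubularNbhd.SmoothnessFacts] {A Kj : Knot} (ν : Knot.TubularNbhd Kj)
  {avoid : Set (Metric.sphere (0 : EuclideanSpace ℝ (Fin 4)) 1)} (b : BandCore A ν.pushOff avoid)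

/-- **The rate at which the band leaves the push-off** at height `y`:
`κ(y) = -2 (D W (1, y) (1, 0))₀`, so that `D W (1, y) (1, 0) = -κ(y) • e₀` when that derivative is
radial (`e₀ = (1/2, 0)`). [cite: Kirby1989, Ch. I §4] -/
def edgeRate (y : ℝ) : ℝ := -2 * (fderiv ℝ (b.tubeNormal ν) (pt2 1 y) (pt2 1 0)) 0

/-- **The flat model of the thickening**:
`(x, z) ↦ ν (circlePt (thetaB x₁), (1 + (1 - x₀) κ(x₁)) • e₀ + z • e_y)`. [folklore] -/
def thickeningFlat (p : EuclideanSpace ℝ (Fin 2) × ℝ) : Metric.sphere (0 : EuclideanSpace ℝ (Fin 4)) 1 :=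
  ν (circlePt (b.thetaB (p.1 1)),
    (1 + (1 - p.1 0) * b.edgeRate ν (p.1 1)) • framingBaseVector + p.2 • EuclideanSpace.single (1 : Fin 2) (1 : ℝ))

/-- Unfolding `edgeRate`. [folklore] -/
theorem edgeRate_def (y : ℝ) : b.edgeRate ν y = -2 * (fderiv ℝ (b.tubeNormal ν) (pt2 1 y) (pt2 1 0)) 0 := rfl

/-- Unfolding `thickeningFlat`. [folklore] -/
theorem thickeningFlat_apply (x : EuclideanSpace ℝ (Fin 2)) (z : ℝ) :
    b.thickeningFlat ν (x, z) = ν (circlePt (b.thetaB (x 1)),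
      (1 + (1 - x 0) * b.edgeRate ν (x 1)) • framingBaseVector + z • EuclideanSpace.single (1 : Fin 2) (1 : ℝ)) := rfl

/-- **On the edge the flat model is the push-off**: `thickeningFlat ((1, y), 0) = Kⱼ' (circlePt (thetaB y))`.
[folklore] -/
theorem thickeningFlat_pt2_one_zero (y : ℝ) :
    b.thickeningFlat ν (pt2 1 y, 0) = ν.pushOff (circlePt (b.thetaB y)) := by
  rw [thickeningFlat_apply, Knot.TubularNbhd.pushOff_apply]
  have h0 : (pt2 1 y : EuclideanSpace ℝ (Fin 2)) 0 = 1 := rfl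
  have h1 : (pt2 1 y : EuclideanSpace ℝ (Fin 2)) 1 = y := rfl
  rw [h0, h1, sub_self, zero_mul, add_zero, one_smul, zero_smul, add_zero]

/-- **The band of the flat model is radial**: `thickeningFlat (x, 0) = ν (circlePt (thetaB x₁), r • e₀)`
with `r = 1 + (1 - x₀) κ(x₁)`. [folklore] -/
theorem thickeningFlat_zero (x : EuclideanSpace ℝ (Fin 2)) :
    b.thickeningFlat ν (x, 0) = ν (circlePt (b.thetaB (x 1)), (1 + (1 - x 0) * b.edgeRate ν (x 1)) • framingBaseVector) := by
  rw [thickeningFlat_apply, zero_smul, add_zero]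

/-- `edgeRate` is `C^∞` on `(1/10, 9/10)`. [folklore] -/
theorem contDiffOn_edgeRate : ContDiffOn ℝ ∞ (b.edgeRate ν) (Ioo (10⁻¹ : ℝ) (9 / 10)) := by
  have h := b.contDiffOn_tubeNormalDeriv ν
  have h0 : ContDiffOn ℝ ∞ (fun y : ℝ ↦ (fderiv ℝ (b.tubeNormal ν) (pt2 1 y) (pt2 1 0)) 0) (Ioo (10⁻¹ : ℝ) (9 / 10)) :=
    (contDiff_euclidean.1 contDiff_id 0).comp_contDiffOn h
  exact contDiffOn_const.mul h0

/-- **After step A, `D W (1, y) (1, 0) = -κ(y) • e₀` with `κ(y) > 0`.** If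
`D W (1, y) (1, 0) = -c • e₀` for some `c > 0` then `c = edgeRate y` (so `edgeRate y > 0`).
[folklore] -/
theorem edgeRate_eq_of_fderiv_eq {y c : ℝ} (h : fderiv ℝ (b.tubeNormal ν) (pt2 1 y) (pt2 1 0) = (-c) • framingBaseVector) :
    b.edgeRate ν y = c := by
  rw [edgeRate_def, h]
  simp [framingBaseVector]
  ring

/-- **The coordinates of the flat model and their derivative at the edge.** The flat model is
`ν ∘ (circlePt × id) ∘ Ξ₀♭` with `Ξ₀♭ (x, z) = (thetaB x₁, (1 + (1 - x₀) κ(x₁)) • e₀ + z • e_y)`; at an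
edge point `((1, y), 0)`, `y ∈ (1/10, 9/10)`, `Ξ₀♭` has derivative
`(v, ζ) ↦ (thetaB′(y) v₁, (-κ(y) v₀) • e₀ + ζ • e_y)`. [folklore] -/
theorem hasFDerivAt_thickeningFlatCoord {y : ℝ} (hy : y ∈ Ioo (10⁻¹ : ℝ) (9 / 10)) :
    HasFDerivAt (fun p : EuclideanSpace ℝ (Fin 2) × ℝ ↦
        ((b.thetaB (p.1 1), (1 + (1 - p.1 0) * b.edgeRate ν (p.1 1)) • framingBaseVector +
          p.2 • EuclideanSpace.single (1 : Fin 2) (1 : ℝ)) : ℝ × EuclideanSpace ℝ (Fin 2)))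
      (((deriv b.thetaB y) • ((EuclideanSpace.proj (1 : Fin 2)).comp (ContinuousLinearMap.fst ℝ _ ℝ))).prod
        (((-b.edgeRate ν y) • ((EuclideanSpace.proj (0 : Fin 2)).comp (ContinuousLinearMap.fst ℝ _ ℝ))).smulRight
            framingBaseVector +
          (ContinuousLinearMap.snd ℝ (EuclideanSpace ℝ (Fin 2)) ℝ).smulRight (EuclideanSpace.single (1 : Fin 2) (1 : ℝ))))
      (pt2 1 y, 0) := by
  have hI : IsOpen (Ioo (10⁻¹ : ℝ) (9 / 10)) := isOpen_Ioo
  -- the two coordinate projections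
  have hx0 : HasFDerivAt (fun p : EuclideanSpace ℝ (Fin 2) × ℝ ↦ p.1 0)
      ((EuclideanSpace.proj (0 : Fin 2)).comp (ContinuousLinearMap.fst ℝ _ ℝ)) (pt2 1 y, 0) :=
    ((EuclideanSpace.proj (0 : Fin 2)).comp (ContinuousLinearMap.fst ℝ (EuclideanSpace ℝ (Fin 2)) ℝ)).hasFDerivAt
  have hx1 : HasFDerivAt (fun p : EuclideanSpace ℝ (Fin 2) × ℝ ↦ p.1 1)
      ((EuclideanSpace.proj (1 : Fin 2)).comp (ContinuousLinearMap.fst ℝ _ ℝ)) (pt2 1 y, 0) :=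
    ((EuclideanSpace.proj (1 : Fin 2)).comp (ContinuousLinearMap.fst ℝ (EuclideanSpace ℝ (Fin 2)) ℝ)).hasFDerivAt
  have hval1 : (fun p : EuclideanSpace ℝ (Fin 2) × ℝ ↦ p.1 1) (pt2 1 y, 0) = y := rfl
  have hval0 : (fun p : EuclideanSpace ℝ (Fin 2) × ℝ ↦ p.1 0) (pt2 1 y, 0) = 1 := rfl
  -- `thetaB (p.1 1)`
  have hth : HasDerivAt b.thetaB (deriv b.thetaB y) y := ((b.contDiffAt_thetaB hy).differentiableAt (by simp)).hasDerivAt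
  have h1 : HasFDerivAt (fun p : EuclideanSpace ℝ (Fin 2) × ℝ ↦ b.thetaB (p.1 1))
      ((deriv b.thetaB y) • ((EuclideanSpace.proj (1 : Fin 2)).comp (ContinuousLinearMap.fst ℝ _ ℝ))) (pt2 1 y, 0) := by
    have h := hth.hasFDerivAt.comp ((pt2 1 y : EuclideanSpace ℝ (Fin 2)), (0 : ℝ)) hx1
    refine h.congr_fderiv (ContinuousLinearMap.ext fun v ↦ ?_)
    simp [mul_comm]
  -- `edgeRate (p.1 1)`
  have hκ : HasDerivAt (b.edgeRate ν) (deriv (b.edgeRate ν) y) y :=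
    (((b.contDiffOn_edgeRate ν).contDiffAt (hI.mem_nhds hy)).differentiableAt (by simp)).hasDerivAt
  have h2 : HasFDerivAt (fun p : EuclideanSpace ℝ (Fin 2) × ℝ ↦ b.edgeRate ν (p.1 1))
      ((deriv (b.edgeRate ν) y) • ((EuclideanSpace.proj (1 : Fin 2)).comp (ContinuousLinearMap.fst ℝ _ ℝ))) (pt2 1 y, 0) := by
    have h := hκ.hasFDerivAt.comp ((pt2 1 y : EuclideanSpace ℝ (Fin 2)), (0 : ℝ)) hx1
    refine h.congr_fderiv (ContinuousLinearMap.ext fun v ↦ ?_)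
    simp [mul_comm]
  -- the radius `1 + (1 - p.1 0) * edgeRate (p.1 1)`
  have hsub : HasFDerivAt (fun p : EuclideanSpace ℝ (Fin 2) × ℝ ↦ (1 : ℝ) - p.1 0)
      (-((EuclideanSpace.proj (0 : Fin 2)).comp (ContinuousLinearMap.fst ℝ _ ℝ))) (pt2 1 y, 0) := by
    have h := (hasFDerivAt_const (1 : ℝ) ((pt2 1 y : EuclideanSpace ℝ (Fin 2)), (0 : ℝ))).sub hx0
    refine h.congr_fderiv ?_
    rw [zero_sub]
  have h3 : HasFDerivAt (fun p : EuclideanSpace ℝ (Fin 2) × ℝ ↦ 1 + (1 - p.1 0) * b.edgeRate ν (p.1 1))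
      ((-b.edgeRate ν y) • ((EuclideanSpace.proj (0 : Fin 2)).comp (ContinuousLinearMap.fst ℝ _ ℝ))) (pt2 1 y, 0) := by
    have hmul := hsub.mul h2
    have h := (hasFDerivAt_const (1 : ℝ) ((pt2 1 y : EuclideanSpace ℝ (Fin 2)), (0 : ℝ))).add hmul
    refine h.congr_fderiv (ContinuousLinearMap.ext fun v ↦ ?_)
    simp
  have h4 : HasFDerivAt (fun p : EuclideanSpace ℝ (Fin 2) × ℝ ↦ (1 + (1 - p.1 0) * b.edgeRate ν (p.1 1)) • framingBaseVector)
      (((-b.edgeRate ν y) • ((EuclideanSpace.proj (0 : Fin 2)).comp (ContinuousLinearMap.fst ℝ _ ℝ))).smulRight framingBaseVector)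
      (pt2 1 y, 0) := h3.smul_const _
  have h5 : HasFDerivAt (fun p : EuclideanSpace ℝ (Fin 2) × ℝ ↦ p.2 • EuclideanSpace.single (1 : Fin 2) (1 : ℝ))
      ((ContinuousLinearMap.snd ℝ (EuclideanSpace ℝ (Fin 2)) ℝ).smulRight (EuclideanSpace.single (1 : Fin 2) (1 : ℝ))) (pt2 1 y, 0) :=
    (hasFDerivAt_snd (𝕜 := ℝ) (E := EuclideanSpace ℝ (Fin 2)) (F := ℝ) (p := (pt2 1 y, 0))).smul_const _
  exact h1.prodMk (h4.add h5)

/-- **Convex combinations of the derivatives of the two thickenings at the edge are injective.**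
For `y ∈ (1/10, 9/10)` with `D W (1, y) (1, 0) = -c • e₀`, `c ≠ 0`, and every `s : ℝ`, the map
`(v, ζ) ↦ (1 - s) • D Ξ₀ (v, ζ) + s • D Ξ₀♭ (v, ζ)` is injective (its second component is
`-c v₀ • e₀ + ζ • e_y`, its first `(1 - s) a v₀ + thetaB′ v₁`). [folklore] -/
theorem injective_convex_thickeningCoord {y : ℝ} (hy : y ∈ Ioo (10⁻¹ : ℝ) (9 / 10)) {c : ℝ} (hc : c ≠ 0)
    (hA : fderiv ℝ (b.tubeNormal ν) (pt2 1 y) (pt2 1 0) = (-c) • framingBaseVector) (s : ℝ) :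
    Injective ((1 - s) • (((fderiv ℝ (b.baseLift ν) (pt2 1 y)).comp (ContinuousLinearMap.fst ℝ _ ℝ)).prod
        ((fderiv ℝ (b.tubeNormal ν) (pt2 1 y)).comp (ContinuousLinearMap.fst ℝ _ ℝ) +
          (ContinuousLinearMap.snd ℝ (EuclideanSpace ℝ (Fin 2)) ℝ).smulRight (EuclideanSpace.single (1 : Fin 2) (1 : ℝ)))) +
      s • ((((deriv b.thetaB y) • ((EuclideanSpace.proj (1 : Fin 2)).comp (ContinuousLinearMap.fst ℝ _ ℝ))).prod
        (((-b.edgeRate ν y) • ((EuclideanSpace.proj (0 : Fin 2)).comp (ContinuousLinearMap.fst ℝ _ ℝ))).smulRight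
            framingBaseVector +
          (ContinuousLinearMap.snd ℝ (EuclideanSpace ℝ (Fin 2)) ℝ).smulRight (EuclideanSpace.single (1 : Fin 2) (1 : ℝ)))))) := by
  set LΘ := fderiv ℝ (b.baseLift ν) (pt2 1 y) with hLΘ
  set LW := fderiv ℝ (b.tubeNormal ν) (pt2 1 y) with hLW
  have hΘ1 : LΘ (pt2 0 1) = deriv b.thetaB y := b.fderiv_baseLift_pt2_one_vertical ν hy
  have hW1 : LW (pt2 0 1) = 0 := b.fderiv_tubeNormal_pt2_one_vertical ν hy
  have hW0 : LW (pt2 1 0) = (-c) • framingBaseVector := hA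
  have hκ : b.edgeRate ν y = c := b.edgeRate_eq_of_fderiv_eq ν hA
  have hth : deriv b.thetaB y ≠ 0 := (b.deriv_thetaB_neg hy).ne
  refine (injective_iff_map_eq_zero _).2 fun p hp ↦ ?_
  obtain ⟨v, ζ⟩ := p
  have hv : v = (v 0) • (pt2 1 0 : EuclideanSpace ℝ (Fin 2)) + (v 1) • pt2 0 1 := by
    ext i; fin_cases i <;> simp [pt2]
  have h1 := congrArg Prod.fst hp
  have h2 := congrArg Prod.snd hp
  simp only [add_apply, FunLike.coe_smul, Pi.smul_apply,
    ContinuousLinearMap.prod_apply, ContinuousLinearMap.coe_comp, comp_apply,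
    ContinuousLinearMap.coe_fst', ContinuousLinearMap.smulRight_apply, ContinuousLinearMap.coe_snd',
    Prod.smul_mk, Prod.mk_add_mk, Prod.fst_zero, Prod.snd_zero, smul_eq_mul] at h1 h2
  have hp0 : (EuclideanSpace.proj (0 : Fin 2) : EuclideanSpace ℝ (Fin 2) →L[ℝ] ℝ) v = v 0 := rfl
  have hp1 : (EuclideanSpace.proj (1 : Fin 2) : EuclideanSpace ℝ (Fin 2) →L[ℝ] ℝ) v = v 1 := rfl
  rw [hp1] at h1
  rw [hp0, hκ] at h2
  have hLΘv : LΘ v = v 0 * LΘ (pt2 1 0) + v 1 * deriv b.thetaB y := by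
    conv_lhs => rw [hv]
    rw [map_add, map_smul, map_smul, hΘ1, smul_eq_mul, smul_eq_mul]
  have hLWv : LW v = (v 0 * (-c)) • framingBaseVector := by
    conv_lhs => rw [hv]
    rw [map_add, map_smul, map_smul, hW0, hW1, smul_zero, add_zero, smul_smul]
  rw [hLΘv] at h1
  rw [hLWv] at h2
  -- second component: `((1-s)(v₀(-c)) + s(-c v₀)) • e₀ + ((1-s)ζ + sζ) • e_y = 0`
  have hfb : framingBaseVector = (1 / 2 : ℝ) • EuclideanSpace.single (0 : Fin 2) (1 : ℝ) := by
    ext i; fin_cases i <;> simp [framingBaseVector]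
  rw [hfb] at h2
  have e0 := congrArg (fun w : EuclideanSpace ℝ (Fin 2) ↦ w 0) h2
  have e1 := congrArg (fun w : EuclideanSpace ℝ (Fin 2) ↦ w 1) h2
  simp at e0 e1
  have hv0 : v 0 = 0 := by
    have : v 0 * c = 0 := by nlinarith [e0]
    rcases mul_eq_zero.1 this with h | h
    · exact h
    · exact absurd h hc
  have hζ : ζ = 0 := by linarith [e1]
  rw [hv0] at h1
  have hv1 : v 1 = 0 := by
    have : v 1 * deriv b.thetaB y = 0 := by nlinarith [h1]
    rcases mul_eq_zero.1 this with h | h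
    · exact h
    · exact absurd h hth
  have hv00 : v = 0 := by rw [hv, hv0, hv1, zero_smul, zero_smul, add_zero]
  simp only [hv00, hζ, Prod.mk_eq_zero, and_self]

end BandCore

end Literature.Topology.FourManifolds
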